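import Summits.AtomisticToContinuum.HydrodynamicLimit.Theorems.AntiMazurCoboundariesKineticFluxLdDecayHTheoremObjects
import Summits.AtomisticToContinuum.HydrodynamicLimit.Theorems.OneFlightGossipEngineKineticCurrentsWindowLDUniformLedgerAssemblyDuality
import HarnessLib

/-!
# Window duality for the crux line `h-theorem-dissipation-budget` (crux `KineticFluxLdDecay`,
# stmt-AtomisticToContinuum-10967) — registered stub `stub_windowDuality` (S1)

The Donsker–Varadhan step of the line at finite `N`, in the abstract frame of
`Theorems/AntiMazurCoboundariesKineticFluxLdDecayHTheoremObjects.lean` (statement `HTheorem.WindowDuality`):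
for a hard-sphere flow `Φ` on `𝕋³`, a probability law `μ` carried by the good set, a bounded measurable
observable `F` and a window `h > 0`, with `X = h⁻¹ ∫₀ʰ F∘Φ_t dt` and the tilted law `μ^X = μ.tilted X`:

* `μ^X` is a probability law, `μ^X ≪ μ`, `KL(μ^X ‖ μ) < ∞` and
  `E_μ e^X = exp (E_{μ^X} X − KL(μ^X ‖ μ))` — the Gibbs variational identity
  (`LedgerAssembly.klDiv_tilted_eq`), valid here because `X` is bounded by the bound of `F`
  (`HTheorem.abs_windowAvg_le`) and `μ`-a.e. measurable (`HTheorem.aemeasurable_windowAvg`):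
  `tilted_duality_of_bounded`;
* `t ↦ E_{μ^X} F∘Φ_t` is integrable on the window and `E_{μ^X} X = h⁻¹ ∫₀ʰ E_{μ^X} F∘Φ_t dt` — Fubini for
  the bounded integrand `(z, t) ↦ F (Φ_t z)`, jointly a.e.-measurable on `μ^X ⊗ Leb|(0,h]` because `μ^X`
  is carried by the good set (`HardSphereFlow.aemeasurable_comp_flow_prod_torus`): `windowAvg_fubini`.

Reference: C. Kipnis, C. Landim, *Scaling Limits of Interacting Particle Systems* (1999), App. 1 §8.
-/

noncomputable section

open MeasureTheory ProbabilityTheory Set Filter InformationTheory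
open scoped ENNReal

namespace Summit.AtomisticToContinuum.HydrodynamicLimit.Theorems.HTheorem

open Literature.Analysis.FluidPDE (HardSphereFlow Config)
open Summit.AtomisticToContinuum.HydrodynamicLimit.Theorems.KineticCurrentsWindowLDUniformGossip
  (LedgerAssembly.klDiv_tilted_eq)

/-! ### Generic measure theory: bounded exponents -/

/-- A bounded a.e.-measurable real function is integrable against a finite measure. -/
theorem integrable_of_aemeasurable_of_abs_le {α : Type*} [MeasurableSpace α] {μ : Measure α}
    [IsFiniteMeasure μ] {f : α → ℝ} (hf : AEMeasurable f μ) {C : ℝ} (hC : ∀ x, |f x| ≤ C) :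
    Integrable f μ :=
  (integrable_const C).mono' hf.aestronglyMeasurable
    (ae_of_all _ fun x => by simpa only [Real.norm_eq_abs] using hC x)

/-- **Gibbs variational identity for a bounded a.e.-measurable exponent.** For a probability law `μ` and
a bounded `μ`-a.e. measurable `X`: the tilted law `μ.tilted X` is a probability law, absolutely continuous
w.r.t. `μ`, of finite relative entropy, and `∫⁻ e^X dμ = exp (∫ X d(μ.tilted X) − KL(μ.tilted X ‖ μ))`
(`LedgerAssembly.klDiv_tilted_eq`, i.e. `KL = ∫ X dμ^X − log ∫ e^X dμ`, rearranged). -/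
theorem tilted_duality_of_bounded {α : Type*} [MeasurableSpace α] {μ : Measure α}
    [IsProbabilityMeasure μ] {X : α → ℝ} (hXm : AEMeasurable X μ) {C : ℝ} (hXb : ∀ x, |X x| ≤ C) :
    IsProbabilityMeasure (μ.tilted X) ∧ μ.tilted X ≪ μ ∧ klDiv (μ.tilted X) μ ≠ ⊤ ∧
      ∫⁻ x, ENNReal.ofReal (Real.exp (X x)) ∂μ =
        ENNReal.ofReal (Real.exp ((∫ x, X x ∂(μ.tilted X)) - (klDiv (μ.tilted X) μ).toReal)) := by
  have hexp : Integrable (fun x => Real.exp (X x)) μ :=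
    integrable_of_aemeasurable_of_abs_le (Real.measurable_exp.comp_aemeasurable hXm) fun x => by
      rw [Real.abs_exp]
      exact Real.exp_le_exp.2 ((le_abs_self _).trans (hXb x))
  haveI hP : IsProbabilityMeasure (μ.tilted X) := isProbabilityMeasure_tilted hexp
  have hac : μ.tilted X ≪ μ := tilted_absolutelyContinuous μ X
  have hXQ : Integrable X (μ.tilted X) :=
    integrable_of_aemeasurable_of_abs_le (hXm.mono_ac hac) hXb
  obtain ⟨hkl, hklr⟩ := LedgerAssembly.klDiv_tilted_eq hexp hXQ
  refine ⟨hP, hac, hkl, ?_⟩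
  rw [hklr, sub_sub_cancel, Real.exp_log (integral_exp_pos hexp)]
  exact (ofReal_integral_eq_lintegral_ofReal hexp (ae_of_all _ fun _ => (Real.exp_pos _).le)).symm

/-! ### Fubini for the window average -/

section Frame

variable {ε : ℝ} {n : ℕ}

/-- **Fubini for the window average under a finite law carried by the good set.** For a hard-sphere flow
`Φ` on `𝕋³`, a finite measure `ν` with `ν(goodᶜ) = 0`, a bounded measurable `F` and `h > 0`: the time-`t`
means `t ↦ ∫ F∘Φ_t dν` are integrable on the window and `∫ X dν = h⁻¹ ∫₀ʰ (∫ F∘Φ_t dν) dt` for the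
window average `X = h⁻¹ ∫₀ʰ F∘Φ_t dt` (the integrand `(z, t) ↦ F (Φ_t z)` is bounded and jointly
a.e.-measurable on `ν ⊗ Leb|(0,h]`, `HardSphereFlow.aemeasurable_comp_flow_prod_torus`). -/
theorem windowAvg_fubini (Φ : TFlow ε n) {ν : Measure (TPhase n)} [IsFiniteMeasure ν]
    (hν : ν Φ.goodᶜ = 0) {F : TPhase n → ℝ} (hF : Measurable F) {C : ℝ} (hC : ∀ z, |F z| ≤ C)
    {h : ℝ} (hh : 0 < h) :
    IntervalIntegrable (fun t => ∫ z, F (Φ.flow t z) ∂ν) volume 0 h ∧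
      ∫ z, windowAvg Φ F h z ∂ν = h⁻¹ * ∫ t in (0 : ℝ)..h, ∫ z, F (Φ.flow t z) ∂ν := by
  -- the integrand `(z, t) ↦ F (Φ_t z)` on `ν ⊗ Leb|(0, h]`
  have hGm : AEMeasurable (fun p : TPhase n × ℝ => F (Φ.flow p.2 p.1))
      (ν.prod (volume.restrict (Ioc 0 h))) :=
    Φ.aemeasurable_comp_flow_prod_torus hν _ (0 : ℝ) hF
  have hGi : Integrable (fun p : TPhase n × ℝ => F (Φ.flow p.2 p.1))
      (ν.prod (volume.restrict (Ioc 0 h))) :=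
    integrable_of_aemeasurable_of_abs_le hGm fun p => hC _
  refine ⟨(intervalIntegrable_iff_integrableOn_Ioc_of_le hh.le).2 hGi.integral_prod_right, ?_⟩
  have hswap :
      ∫ z, (∫ t in Ioc 0 h, F (Φ.flow t z)) ∂ν = ∫ t in Ioc 0 h, (∫ z, F (Φ.flow t z) ∂ν) :=
    integral_integral_swap (f := fun z t => F (Φ.flow t z)) hGi
  unfold windowAvg pathInt
  simp only [intervalIntegral.integral_of_le hh.le]
  rw [integral_const_mul, hswap]

end Frame

/-! ### The registered stub -/

/-- **S1 `stub_windowDuality` — Gibbs variational identity + Fubini for the window average** (statement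
`HTheorem.WindowDuality`; registered stub of line `h-theorem-dissipation-budget`, crux
stmt-AtomisticToContinuum-10967): `tilted_duality_of_bounded` for the bounded, a.e.-measurable window
average (`abs_windowAvg_le`, `aemeasurable_windowAvg`) and `windowAvg_fubini` for the tilted law, which is
carried by the good set since it is `≪ μ`. -/
theorem stub_windowDuality : WindowDuality := by
  intro ε n Φ μ hμ hgood F hF hC h hh
  obtain ⟨C, hC⟩ := hC
  obtain ⟨hP, hac, hkl, hdual⟩ := tilted_duality_of_bounded (aemeasurable_windowAvg Φ hgood hF h)
    fun z => abs_windowAvg_le Φ hC hh z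
  obtain ⟨hii, hfub⟩ := windowAvg_fubini Φ (ν := μ.tilted (windowAvg Φ F h)) (hac hgood) hF hC hh
  exact ⟨hP, hac, hkl, hdual, hii, hfub⟩

end Summit.AtomisticToContinuum.HydrodynamicLimit.Theorems.HTheorem

end
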